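import Mathlib
import HarnessLib
import Summits.CriticalPhenomena.Ising3DConformalLimit.Theses.BallSpecification
import Summits.CriticalPhenomena.Ising3DConformalLimit.Theorems.BallSpecificationLatticePuncturedUniquenessConditioning
import Summits.CriticalPhenomena.Ising3DConformalLimit.Theorems.BallSpecificationLatticePuncturedUniquenessSandwich
import Literature.Probability.LatticeModels.PlusMinusStateGibbs

/-!
# `LatticePuncturedUniqueness` — a point defect at criticality carries only its own spin
(route BallSpecification, support item stmt-CriticalPhenomena-5730: PROOF)

**Theorem** (`latticePuncturedUniqueness_proof`, literally the route decl
`LatticePuncturedUniqueness`). Every probability measure `ν` on `{±1}^{ℤ³}` that satisfies the DLR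
equations of the critical nearest-neighbour Ising specification `γ = isingSpecification (zdGraph 3) β_c 0`
for all finite volumes NOT containing the origin, and has `∫ σ_0 dν = 0`, is a Gibbs measure for the
full specification (hence the unique critical state, `hasUniqueGibbsMeasure_criticalBeta_holds`).

**Proof** (finite-volume version of the planner's sketch; no weak limits of measures are needed).
Let `μ = μ⁺_{β_c}` be the plus state (`exists_plusMeasure_holds`), a Gibbs measure with
`∫ σ_0 dμ = m*(β_c) = 0` (`spontaneousMagnetization_criticalBeta_eq_zero_holds`, ADS 2015). Both `ν`
and `μ` satisfy the DLR equations for the punctured boxes `B(L) ∖ {0}` and give mass `1/2` to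
`{σ_0 = s}`, `s = ±1`. For a finite `B ∌ 0`, DLR + properness + monotonicity in the boundary
condition sandwich `ρ({σ_B ≡ +1} ∩ {σ_0 = s})`, `ρ ∈ {ν, μ}`, between `½ μ^{∓[0↦s]}_{B(L)∖0}(σ_B ≡ +1)`
(helper file `…Sandwich`), so `|ν − μ|` on this event is at most the punctured gap
`∑_{i∈B} (μ^{+[0↦s]}_{B(L)∖0} − μ^{−[0↦s]}_{B(L)∖0})(σ_i = 1)`. By the conditioning identity
(consistency of the specification) the punctured kernels are the boxes `B(L)` with `±` boundary
condition conditioned on `σ_0 = s`, which turns the punctured single-site gap into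
`(⟨σ_i⟩⁺_{B(L)} − ⟨σ_iσ_0⟩⁺_{B(L)}⟨σ_0⟩⁺_{B(L)})/(1 − ⟨σ_0⟩⁺_{B(L)}²) → 0`, because
`⟨σ_x⟩⁺_{B(L);β_c} → m*(β_c) = 0` (helper file `…Conditioning`). Hence `ν` and `μ` agree on the
`π`-system `{σ_B ≡ +1}` restricted to each `{σ_0 = s}`, so `ν|_{σ_0 = s} = μ|_{σ_0 = s}` and `ν = μ`.

References: S. Friedli, Y. Velenik, *Statistical Mechanics of Lattice Systems* (CUP 2017), Thm. 3.28,
Lemma 6.7, Lemma 6.65; M. Aizenman, H. Duminil-Copin, V. Sidoravicius, CMP 334 (2015), Thm. 1.2;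
H.-O. Georgii, *Gibbs Measures and Phase Transitions* (2011), Def. 1.23, Rem. 1.24. No definitions.
-/

namespace Summit.CriticalPhenomena.Ising3DConformalLimit.Theorems

open MeasureTheory Filter Topology Finset
open scoped ENNReal
open Literature.Probability.LatticeModels
open Summit.CriticalPhenomena.Ising3DConformalLimit.Theorems.LatticePunctured

/-- **Two punctured-DLR measures with equal mass on `{σ_0 = s}` agree on
`{σ_B ≡ +1} ∩ {σ_0 = s}` for `B ∌ 0`**, on `ℤ^d` at `β ≥ 0`, whenever the finite-volume plus
magnetisations `⟨σ_x⟩⁺_{B(L);β,0}` tend to `0` for every `x`: both measures are sandwiched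
(`abs_sub_le_of_punctured_dlr`) within the punctured gap of `B(L) ∖ {0}`, which tends to `0`
(`tendsto_puncturedGap`). (Friedli–Velenik 2017, Thm. 3.28, p. 117, punctured at the origin.) [cite: FriedliVelenik2017, Thm. 3.28, p. 117] -/
theorem measureReal_inter_eq_of_punctured_dlr {d : ℕ} {β : ℝ} (hβ : 0 ≤ β)
    (hmag : ∀ x : Site d,
      Tendsto (fun L : ℕ => isingExpect (zdGraph d) (box d L) β 0 .plus (spinAt x)) atTop (𝓝 0))
    {ρ₁ ρ₂ : Measure (SpinConfig (Site d))} [IsProbabilityMeasure ρ₁] [IsProbabilityMeasure ρ₂]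
    (hDLR₁ : ∀ (L : ℕ) (A : Set (SpinConfig (Site d))), MeasurableSet A →
      ∫⁻ η, isingMeasure (zdGraph d) ((box d L).erase 0) β 0 (.fixed η) A ∂ρ₁ = ρ₁ A)
    (hDLR₂ : ∀ (L : ℕ) (A : Set (SpinConfig (Site d))), MeasurableSet A →
      ∫⁻ η, isingMeasure (zdGraph d) ((box d L).erase 0) β 0 (.fixed η) A ∂ρ₂ = ρ₂ A)
    (s : ℤˣ) (hS : ρ₁.real {σ : SpinConfig (Site d) | σ 0 = s} =
      ρ₂.real {σ : SpinConfig (Site d) | σ 0 = s})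
    {B : Finset (Site d)} (hB : (0 : Site d) ∉ B) :
    ρ₁.real ({σ : SpinConfig (Site d) | ∀ i ∈ B, σ i = 1} ∩ {σ : SpinConfig (Site d) | σ 0 = s}) =
      ρ₂.real ({σ : SpinConfig (Site d) | ∀ i ∈ B, σ i = 1} ∩
        {σ : SpinConfig (Site d) | σ 0 = s}) := by
  have hz : ∀ L : ℕ, (0 : Site d) ∉ (box d L).erase 0 := fun L => Finset.notMem_erase 0 _
  have hbound : ∀ L : ℕ,
      |ρ₁.real ({σ : SpinConfig (Site d) | ∀ i ∈ B, σ i = 1} ∩ {σ : SpinConfig (Site d) | σ 0 = s}) -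
        ρ₂.real ({σ : SpinConfig (Site d) | ∀ i ∈ B, σ i = 1} ∩
          {σ : SpinConfig (Site d) | σ 0 = s})| ≤
      ∑ i ∈ B, ((isingMeasure (zdGraph d) ((box d L).erase 0) β 0
          (.fixed (Function.update 1 0 s))).real {σ : SpinConfig (Site d) | σ i = 1} -
        (isingMeasure (zdGraph d) ((box d L).erase 0) β 0
          (.fixed (Function.update (-1) 0 s))).real {σ : SpinConfig (Site d) | σ i = 1}) :=
    fun L => abs_sub_le_of_punctured_dlr (zdGraph d) hβ 0 (hz L) (hDLR₁ L) (hDLR₂ L) s hS B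
  have hlim : Tendsto (fun L : ℕ => ∑ i ∈ B, ((isingMeasure (zdGraph d) ((box d L).erase 0) β 0
          (.fixed (Function.update 1 0 s))).real {σ : SpinConfig (Site d) | σ i = 1} -
        (isingMeasure (zdGraph d) ((box d L).erase 0) β 0
          (.fixed (Function.update (-1) 0 s))).real {σ : SpinConfig (Site d) | σ i = 1}))
      atTop (𝓝 0) := by
    have h := tendsto_finsetSum B fun i hi =>
      tendsto_puncturedGap (d := d) (β := β) (ne_of_mem_of_not_mem hi hB) s hmag
    simpa using h
  have h0 := le_of_tendsto_of_tendsto' tendsto_const_nhds hlim hbound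
  exact sub_eq_zero.1 (abs_nonpos_iff.1 h0)

/-- If `∫ σ_z dρ = 0` for a probability measure `ρ`, then `ρ(σ_z = s) = 1/2` for `s = ±1`
(`ρ(σ_z = s) = (1 + s̃ ∫σ_z dρ)/2`, Friedli–Velenik 2017, §3.6.2). [cite: FriedliVelenik2017, §3.6.2, p. 107] -/
theorem measureReal_apply_eq_one_half {V : Type*} (ρ : Measure (SpinConfig V))
    [IsProbabilityMeasure ρ] (z : V) (h0 : ∫ σ, spinAt z σ ∂ρ = 0) (s : ℤˣ) :
    ρ.real {σ : SpinConfig V | σ z = s} = 1 / 2 := by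
  rw [measureReal_apply_eq, h0, mul_zero, add_zero]

/-- **A point defect at criticality carries only its own spin** (`LatticePuncturedUniqueness`,
item stmt-CriticalPhenomena-5730 of route BallSpecification): every probability measure on
`{±1}^{ℤ³}` satisfying the DLR equations of the critical Ising specification for all finite volumes
not containing the origin, with `∫ σ_0 dν = 0`, is a Gibbs measure for the full specification — in
fact it equals the plus state `μ⁺_{β_c}`. Inputs: `m*(β_c) = 0` in `d = 3`
(Aizenman–Duminil-Copin–Sidoravicius 2015, `spontaneousMagnetization_criticalBeta_eq_zero_holds`),
existence of the plus state as a Gibbs measure (`exists_plusMeasure_holds`), the thermodynamic limit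
of the plus magnetisation (`hasBoxLimit_isingCorr_plus_holds`), consistency / properness /
monotonicity of the Ising kernels (helper files `…Conditioning`, `…Sandwich`).
[cite: AizenmanDuminilCopinSidoraviciusCMP2015, Thm. 1.2] [cite: FriedliVelenik2017, Thm. 3.28 and Lemma 6.7] -/
theorem latticePuncturedUniqueness_proof :
    Summit.CriticalPhenomena.Ising3DConformalLimit.Theses.BallSpecification.LatticePuncturedUniqueness := by
  intro ν hν hDLR h0
  have hβ : 0 ≤ criticalBeta 3 := criticalBeta_nonneg 3
  -- the plus state at `β_c`: a Gibbs measure with `∫ σ_0 dμ = m*(β_c) = 0`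
  obtain ⟨μ, hμG, -, hcorr⟩ := exists_plusMeasure_holds (d := 3) (β := criticalBeta 3) (h := 0) hβ
  have hμ : IsGibbsMeasure (isingSpecification (zdGraph 3) (criticalBeta 3) 0) μ := hμG
  haveI : IsProbabilityMeasure μ := hμ.1
  have hm0 : spontaneousMagnetization 3 (criticalBeta 3) = 0 :=
    spontaneousMagnetization_criticalBeta_eq_zero_holds (d := 3) (by norm_num)
  have hmag : ∀ x : Site 3, Tendsto (fun L : ℕ =>
      isingExpect (zdGraph 3) (box 3 L) (criticalBeta 3) 0 .plus (spinAt x)) atTop (𝓝 0) := by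
    intro x
    have h := tendsto_isingExpect_plus_spinAt hasBoxLimit_isingCorr_plus_holds hβ x
    rwa [plusExpect_spinAt_eq_spontaneousMagnetization_holds hβ x, hm0] at h
  have hμ0 : ∫ σ, spinAt 0 σ ∂μ = 0 := by
    have h1 := hcorr {0}
    have hs : spinProduct ({0} : Finset (Site 3)) = spinAt 0 := by
      funext σ; simp [spinProduct]
    rw [spinCorr, plusCorr, hs] at h1
    rw [h1]
    exact hm0
  -- both measures give mass `1/2` to `{σ_0 = s}` and are punctured-DLR on the boxes `B(L) ∖ {0}`
  have hSν : ∀ s : ℤˣ, ν.real {σ : SpinConfig (Site 3) | σ 0 = s} = 1 / 2 :=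
    measureReal_apply_eq_one_half ν 0 h0
  have hSμ : ∀ s : ℤˣ, μ.real {σ : SpinConfig (Site 3) | σ 0 = s} = 1 / 2 :=
    measureReal_apply_eq_one_half μ 0 hμ0
  have hDLRν : ∀ (L : ℕ) (A : Set (SpinConfig (Site 3))), MeasurableSet A →
      ∫⁻ η, isingMeasure (zdGraph 3) ((box 3 L).erase 0) (criticalBeta 3) 0 (.fixed η) A ∂ν = ν A :=
    fun L A hA => hDLR _ (Finset.notMem_erase 0 _) A hA
  have hDLRμ : ∀ (L : ℕ) (A : Set (SpinConfig (Site 3))), MeasurableSet A →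
      ∫⁻ η, isingMeasure (zdGraph 3) ((box 3 L).erase 0) (criticalBeta 3) 0 (.fixed η) A ∂μ = μ A :=
    fun L A hA => hμ.2 _ A hA
  -- `ν` and `μ` agree on each `{σ_0 = s}`
  have hrestr : ∀ s : ℤˣ, ν.restrict {σ : SpinConfig (Site 3) | σ 0 = s} =
      μ.restrict {σ : SpinConfig (Site 3) | σ 0 = s} := by
    intro s
    refine ext_of_generate_finite _ generateFrom_range_forall_eq_one isPiSystem_range_forall_eq_one
      ?_ ?_
    · rintro _ ⟨B, rfl⟩
      dsimp only
      rw [Measure.restrict_apply (measurableSet_forall_eq_one B),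
        Measure.restrict_apply (measurableSet_forall_eq_one B)]
      by_cases hB : (0 : Site 3) ∈ B
      · by_cases hs : s = 1
        · subst hs
          have hset : ({σ : SpinConfig (Site 3) | ∀ i ∈ B, σ i = 1} ∩
              {σ : SpinConfig (Site 3) | σ 0 = 1}) =
              {σ : SpinConfig (Site 3) | ∀ i ∈ B.erase 0, σ i = 1} ∩
                {σ : SpinConfig (Site 3) | σ 0 = 1} := by
            ext σ
            simp only [Set.mem_inter_iff, Set.mem_setOf_eq, Finset.mem_erase]
            constructor
            · rintro ⟨h1, h2⟩
              exact ⟨fun i hi => h1 i hi.2, h2⟩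
            · rintro ⟨h1, h2⟩
              refine ⟨fun i hi => ?_, h2⟩
              by_cases hi0 : i = 0
              · rw [hi0]; exact h2
              · exact h1 i ⟨hi0, hi⟩
          rw [hset, ← ofReal_measureReal (measure_ne_top ν _), ← ofReal_measureReal (measure_ne_top μ _),
            measureReal_inter_eq_of_punctured_dlr hβ hmag hDLRν hDLRμ 1 ((hSν 1).trans (hSμ 1).symm)
              (Finset.notMem_erase 0 B)]
        · have hset : ({σ : SpinConfig (Site 3) | ∀ i ∈ B, σ i = 1} ∩
              {σ : SpinConfig (Site 3) | σ 0 = s}) = ∅ := by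
            ext σ
            simp only [Set.mem_inter_iff, Set.mem_setOf_eq, Set.mem_empty_iff_false, iff_false,
              not_and]
            intro h1 h2
            exact hs (h2.symm.trans (h1 0 hB))
          rw [hset, measure_empty, measure_empty]
      · rw [← ofReal_measureReal (measure_ne_top ν _), ← ofReal_measureReal (measure_ne_top μ _),
          measureReal_inter_eq_of_punctured_dlr hβ hmag hDLRν hDLRμ s ((hSν s).trans (hSμ s).symm) hB]
    · rw [Measure.restrict_apply_univ, Measure.restrict_apply_univ,
        ← ofReal_measureReal (measure_ne_top ν _), ← ofReal_measureReal (measure_ne_top μ _),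
        hSν, hSμ]
  -- hence `ν = μ`, a Gibbs measure
  have hνμ : ν = μ := by
    have hS1 := measurableSet_apply_eq (V := Site 3) (0 : Site 3) (1 : ℤˣ)
    have hcompl : ({σ : SpinConfig (Site 3) | σ 0 = 1})ᶜ = {σ : SpinConfig (Site 3) | σ 0 = -1} := by
      ext σ
      simp only [Set.mem_compl_iff, Set.mem_setOf_eq]
      exact (intUnits_eq_neg_one_iff (σ 0)).symm
    rw [← Measure.restrict_add_restrict_compl (μ := ν) hS1,
      ← Measure.restrict_add_restrict_compl (μ := μ) hS1, hcompl, hrestr 1, hrestr (-1)]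
  rw [hνμ]
  exact hμG

end Summit.CriticalPhenomena.Ising3DConformalLimit.Theorems
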